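import Summits.Ventures.DiscreteObjects.PP12.NoOrderSeven

/-!
# PP(12): the a-priori list of prime orders of collineations — `p ∈ {2, 3, 5, 11, 13, 157}` (kernel)
Framing: lottery ticket; floor = certified bounds/negative ranges.

**Theorem (`prime_of_collineation_order12`).** If a non-trivial collineation `σ` of a projective plane of order 12
satisfies `σ ^ p = 1` on points for a prime `p`, then `p ∈ {2, 3, 5, 11, 13, 157}` (FAMILY-B1P Lemma 2 with the
`p = 7` case already removed by `NoOrderSeven`). Proof: the number of fixed points is `≡ 157 (mod p)`; if it is
`0` then `p ∣ 157`, a prime; otherwise a fixed point `P` exists and the number of fixed lines through `P` is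
`≡ 13 (mod p)` (dual congruence), so for `p > 13` all 13 lines through `P` are fixed, `P` is a centre, hence
(dual of Hughes–Piper 4.9) there is an axis and `p ∣ 12` or `p ∣ 11` — impossible for `p > 13`.
In print: Janko–van Trung 1982 exclude `5, 11, 13, 157` as well (`{2,3}`-group); the cell re-derives `11`
(census B1-p), `13` (census B1-p+) and `157` (cyclic difference-set control B2); `5` is not reproduced.
-/

namespace Summit.Ventures.DiscreteObjects.PP12

open Configuration Finset

namespace Collineation

variable {P L : Type*} [Membership P L] [ProjectivePlane P L] [Fintype P] [Fintype L]
  [DecidableEq P] [DecidableEq L] (σ : Collineation P L)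

omit [DecidableEq P] in
/-- Dual fixed-line congruence: the number of fixed lines through a fixed point is `≡ order + 1 (mod q)`. -/
theorem fixedThrough_modEq {p : P} [DecidablePred fun m : L => p ∈ m] (hp : σ.onPoints p = p) {q : ℕ}
    [Fact q.Prime] (hq : σ.onPoints ^ q = 1) :
    σ.fixedThrough p ≡ ProjectivePlane.order P L + 1 [MOD q] := by
  rw [fixedThrough_eq_dual, ← ProjectivePlane.Dual.order P L]
  exact σ.dual.fixedOnLine_modEq (l := (p : Dual P)) hp (σ.onLines_pow_eq_one hq)

omit [DecidableEq P] in
/-- A point all of whose lines are fixed is a centre. -/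
theorem isCenter_of_fixedThrough_eq {p : P} [DecidablePred fun m : L => p ∈ m]
    (h : σ.fixedThrough p = ProjectivePlane.order P L + 1) : σ.IsCenter p := by
  rw [fixedThrough_eq_dual, ← ProjectivePlane.Dual.order P L] at h
  exact σ.dual.isAxis_of_fixedOnLine_eq (l := (p : Dual P)) h

omit [DecidableEq P] in
/-- the number of fixed lines through a point is at most the number of lines through it -/
theorem fixedThrough_le (p : P) [DecidablePred fun m : L => p ∈ m] :
    σ.fixedThrough p ≤ ProjectivePlane.order P L + 1 := by
  rw [fixedThrough_eq_dual, ← ProjectivePlane.Dual.order P L]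
  exact σ.dual.fixedOnLine_le (l := (p : Dual P))

omit [DecidableEq P] in
/-- **A collineation of prime order `p > n + 1` with a fixed point is central.** (General order `n`.) -/
theorem exists_axis_of_large_prime {q : ℕ} [hqp : Fact q.Prime] (hq : σ.onPoints ^ q = 1)
    (hlarge : ProjectivePlane.order P L + 1 < q) {p : P} (hp : σ.onPoints p = p) : ∃ l : L, σ.IsAxis l := by
  classical
  have h1 := σ.fixedThrough_modEq hp hq
  have h2 := σ.fixedThrough_le p
  -- both sides are < q, so the congruence is an equality
  have heq : σ.fixedThrough p = ProjectivePlane.order P L + 1 := by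
    have := Nat.ModEq.eq_of_lt_of_lt h1 (lt_of_le_of_lt h2 hlarge) hlarge
    exact this
  exact σ.exists_axis_of_center (σ.isCenter_of_fixedThrough_eq heq)

/-- **The prime list for order 12.** A non-trivial collineation with `σ ^ p = 1` on points, `p` prime, has
`p ∈ {2, 3, 5, 11, 13, 157}`. -/
theorem prime_of_collineation_order12 (h12 : ProjectivePlane.order P L = 12) (hne : σ.onPoints ≠ 1) {p : ℕ}
    (hp : p.Prime) (hq : σ.onPoints ^ p = 1) :
    p = 2 ∨ p = 3 ∨ p = 5 ∨ p = 11 ∨ p = 13 ∨ p = 157 := by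
  classical
  haveI : Fact p.Prime := ⟨hp⟩
  -- small primes: decide membership directly; p = 7 is excluded by NoOrderSeven
  by_cases hsmall : p ≤ 13
  · have h7 : p ≠ 7 := by
      rintro rfl
      exact hne (σ.onPoints_eq_one_of_pow_seven h12 hq)
    interval_cases p <;> simp_all (config := {decide := true})
  · push Not at hsmall
    -- fixed-point count ≡ 157 (mod p)
    have hmod := σ.card_fixedPoints_modEq_card hq
    rw [h12] at hmod
    norm_num at hmod
    by_cases hzero : fixedCard σ.onPoints = 0
    · -- p ∣ 157, and 157 is prime
      rw [hzero] at hmod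
      have hdvd : p ∣ 157 := (Nat.modEq_zero_iff_dvd.mp hmod.symm)
      have h157 : Nat.Prime 157 := by norm_num
      rcases (Nat.dvd_prime h157).mp hdvd with h | h
      · exact absurd h hp.one_lt.ne'
      · exact Or.inr (Or.inr (Or.inr (Or.inr (Or.inr h))))
    · -- a fixed point exists; p > 13 forces a centre, hence an axis, hence p ∣ 12 or p ∣ 11
      unfold fixedCard at hzero
      obtain ⟨x, hx⟩ := Finset.card_pos.mp (Nat.pos_of_ne_zero hzero)
      simp only [mem_filter, mem_univ, true_and] at hx
      obtain ⟨l, hl⟩ := σ.exists_axis_of_large_prime hq (by rw [h12]; omega) hx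
      obtain ⟨c, hc⟩ := σ.exists_center_of_axis hl
      exfalso
      by_cases hcl : c ∈ l
      · have h := σ.dvd_order_of_elation hl hc hcl hne hq
        rw [h12] at h
        have := Nat.le_of_dvd (by norm_num) h
        omega
      · have h := σ.dvd_order_sub_one_of_homology hl hc hcl hne hq
        rw [h12] at h
        have := Nat.le_of_dvd (by norm_num) h
        omega

end Collineation

end Summit.Ventures.DiscreteObjects.PP12
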